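import Literature.Computability.Cryptography.FGProblemZoo
import Mathlib.Data.Nat.Bitwise
import HarnessLib

/-!
# SETH ⇒ OV (fine-grained.S09): the Orthogonal-Vectors instance of a disjunction of CNFs

Machine-free core of the word-RAM proof of `ovConjectureDet_of_sethWordRAM`
(`Literature.Computability.FineGrained.SETHHardness`; R. Williams, *A new algorithm for optimal
2-constraint satisfaction and its implications*, TCS 348 (2005), §5.1, Thm. 5.1 — Theorem 5 of the
author's version; V. Vassilevska Williams, Proc. ICM 2018, §3, Thm. 3.1). Williams' split-and-list
construction turns ONE CNF on `n` variables into an OV instance on `2^{n/2}` vectors per side; the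
word-RAM program of `OVFromSETHProgram.lean` applies it to the whole *disjunction* `ψ₀ ∨ … ∨ ψ_{s-1}`
of sparse CNFs produced by the sparsification lemma and builds a SINGLE OV instance, keeping the
formulas apart by an index gadget. This file defines that instance in closed form and proves its
two properties used by the program's verification:

* `OVRed.ovInst F h H D ℓ N d`: rows `r < N` are pairs `(i, p) = (r / H, r % H)` of a formula index
  and a half-assignment (`H = 2^h`, first-half variables `x < h` read from the bits of `p`,
  second-half variables `h ≤ x` from the bits of `q`); side `A` carries in coordinate `j < D` the bit
  "clause `j` of `ψᵢ` exists and `p` does not satisfy it through a first-half literal", side `B`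
  the bit "… `q` does not satisfy it through a second-half literal"; coordinates `[D, D + 2ℓ)` hold
  the binary index gadget (`bits of i`, complemented bits on side `A`; the other way round on side
  `B`), whose contribution to `⟨u_{(i,p)}, v_{(i',q)}⟩` is the Hamming distance of `i` and `i'`;
  coordinate `D + 2ℓ` is the guard "formula `i` does not exist" on side `A` against the constant `1`
  on side `B`; all further coordinates are `0`;
* **`OVRed.hasOrthogonalPair_ovInst_iff`**: if `|F| ≤ 2^ℓ`, `N = 2^ℓ · H` (exactly: with more rows,
  rows of index `≥ 2^ℓ` have no formula and alias existing indices modulo `2^ℓ`), every formula has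
  at most `D` clauses and variables `< n ≤ 2h`, and `D + 2ℓ + 1 ≤ d`, then the instance has an
  orthogonal pair iff some `ψ ∈ F` is satisfiable (`Complexity.CNF.Satisfiable`, the tree's SAT
  vocabulary; `KCNF.eval φ v = CNF.eval φ.clauses v` is `rfl`);
* the word encoding of the instance in closed form, cell by cell (`OVRed.ycell`,
  `OVRed.getElem_encode_ovInst`, `OVRed.length_encode_ovInst`), as written by the program.

## References

* R. Williams, *A new algorithm for optimal 2-constraint satisfaction and its implications*,
  Theoret. Comput. Sci. 348 (2005) 357–365, §5.1 (Theorem 5 of the author's version = Thm. 5.1).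
* V. Vassilevska Williams, *On some fine-grained questions in algorithms and complexity*,
  Proc. ICM 2018, §3, Thm. 3.1 (proof).
-/

namespace Literature.Computability.FineGrained.OVRed

open Cryptography Complexity

/-! ### Clause lists and half-assignments -/

/-- Clause `C` is satisfied through a *first-half* literal by the half-assignment `p` (variable
`x < h` has the value `p.testBit x`). [folklore] -/
def satFirst (h : ℕ) (C : Clause ℕ) (p : ℕ) : Bool :=
  C.any fun l => decide (l.1 < h) && (p.testBit l.1 == l.2)

/-- Clause `C` is satisfied through a *second-half* literal by the half-assignment `q` (variable
`x ≥ h` has the value `q.testBit (x - h)`). [folklore] -/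
def satSecond (h : ℕ) (C : Clause ℕ) (q : ℕ) : Bool :=
  C.any fun l => decide (h ≤ l.1) && (q.testBit (l.1 - h) == l.2)

/-- The total assignment glued from two half-assignments. [folklore] -/
def glue (h p q : ℕ) : ℕ → Bool := fun x => if x < h then p.testBit x else q.testBit (x - h)

/-- A clause is satisfied by the glued assignment iff it is satisfied through a first-half or a
second-half literal. [folklore] -/
theorem any_glue_iff (h : ℕ) (C : Clause ℕ) (p q : ℕ) :
    (C.any fun l => glue h p q l.1 == l.2) = (satFirst h C p || satSecond h C q) := by
  induction C with
  | nil => simp [satFirst, satSecond]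
  | cons l C ih =>
    simp only [List.any_cons, ih, satFirst, satSecond]
    unfold glue
    by_cases hl : l.1 < h
    · have : ¬ h ≤ l.1 := Nat.not_le.2 hl
      simp only [hl, if_true, decide_true, Bool.true_and, this, decide_false, Bool.false_and,
        Bool.false_or]
      cases (p.testBit l.1 == l.2) <;> simp
    · have : h ≤ l.1 := Nat.not_lt.1 hl
      simp only [hl, if_false, decide_false, Bool.false_and, Bool.false_or, this, decide_true,
        Bool.true_and]
      cases (q.testBit (l.1 - h) == l.2) <;> simp

/-- `CNF.eval` only depends on the values of the variables that occur (clause-wise form of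
`CNF.eval_congr_vars` of `CliqueETH.lean`, which is not imported here). [folklore] -/
theorem cnfEval_congr {ψ : CNF ℕ} {v w : ℕ → Bool}
    (hvw : ∀ C ∈ ψ, ∀ l ∈ C, v l.1 = w l.1) : ψ.eval v = ψ.eval w := by
  unfold CNF.eval
  rw [Bool.eq_iff_iff]
  simp only [List.all_eq_true, List.any_eq_true, Literal.eval, beq_iff_eq]
  exact forall₂_congr fun C hC => exists_congr fun l => and_congr_right fun hl => by
    rw [hvw C hC l hl]

/-- A clause list is true under the glued assignment iff every clause is satisfied through a
first-half or a second-half literal. [folklore] -/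
theorem cnfEval_glue (h : ℕ) (ψ : CNF ℕ) (p q : ℕ) :
    ψ.eval (glue h p q) = ψ.all fun C => satFirst h C p || satSecond h C q := by
  unfold CNF.eval
  induction ψ with
  | nil => rfl
  | cons C ψ ih =>
    simp only [List.all_cons, ih, ← any_glue_iff]
    rfl

/-! ### The instance -/

section inst

variable (F : List (CNF ℕ)) (h H D ℓ : ℕ)

/-- Clause `j` of formula `i`, if both exist. [folklore] -/
def clauseAt (i j : ℕ) : Option (Clause ℕ) :=
  (F[i]?).bind fun ψ => ψ[j]?

/-- Coordinate `j` of the side-`A` vector of row `r = i · H + p`. [folklore] -/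
def uCoord (r j : ℕ) : Bool :=
  if j < D then
    match clauseAt F (r / H) j with
    | some C => !satFirst h C (r % H)
    | none => false
  else if j < D + ℓ then (r / H).testBit (j - D)
  else if j < D + 2 * ℓ then !(r / H).testBit (j - D - ℓ)
  else if j = D + 2 * ℓ then decide (F.length ≤ r / H)
  else false

/-- Coordinate `j` of the side-`B` vector of row `r = i · H + q`. [folklore] -/
def vCoord (r j : ℕ) : Bool :=
  if j < D then
    match clauseAt F (r / H) j with
    | some C => !satSecond h C (r % H)
    | none => false
  else if j < D + ℓ then !(r / H).testBit (j - D)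
  else if j < D + 2 * ℓ then (r / H).testBit (j - D - ℓ)
  else if j = D + 2 * ℓ then true
  else false

/-- **The OV instance of a disjunction of CNFs** (Williams' split-and-list vectors for each `ψᵢ`,
kept apart by the index gadget; see the module docstring). [folklore] -/
def ovInst (N d : ℕ) : OVInstance where
  n := N
  d := d
  A r j := uCoord F h H D ℓ r j
  B r j := vCoord F h H D ℓ r j

variable {F h H D ℓ}

/-- Unfolding `clauseAt` on existing indices. [folklore] -/
theorem clauseAt_eq_some {i j : ℕ} (hi : i < F.length) (hj : j < (F[i]).length) :
    clauseAt F i j = some (F[i][j]) := by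
  simp [clauseAt, List.getElem?_eq_getElem hi, List.getElem?_eq_getElem hj]

/-- `clauseAt` past the clauses of an existing formula. [folklore] -/
theorem clauseAt_eq_none_of_le {i j : ℕ} (hi : i < F.length) (hj : (F[i]).length ≤ j) :
    clauseAt F i j = none := by
  simp [clauseAt, List.getElem?_eq_getElem hi, List.getElem?_eq_none_iff.2 hj]

/-- `clauseAt` past the formulas. [folklore] -/
theorem clauseAt_eq_none_of_length_le {i : ℕ} (hi : F.length ≤ i) (j : ℕ) :
    clauseAt F i j = none := by
  simp [clauseAt, List.getElem?_eq_none_iff.2 hi]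

/-- `clauseAt` of a disjunction with a distinguished last formula. [folklore] -/
theorem clauseAt_append_singleton (G : List (CNF ℕ)) (ψ : CNF ℕ)
    (i j : ℕ) :
    clauseAt (G ++ [ψ]) i j = if i < G.length then clauseAt G i j
      else if i = G.length then ψ[j]? else none := by
  unfold clauseAt
  by_cases h1 : i < G.length
  · rw [if_pos h1, List.getElem?_append_left h1]
  rw [if_neg h1]
  by_cases h2 : i = G.length
  · subst h2
    rw [if_pos rfl, List.getElem?_append_right le_rfl, Nat.sub_self]
    simp
  · rw [if_neg h2, List.getElem?_eq_none_iff.2 (by simp; omega)]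
    simp

/-- `clauseAt` past the formulas of `G` is that of any extension at those indices. [folklore] -/
theorem clauseAt_of_lt (G : List (CNF ℕ)) (ψ : CNF ℕ) {i : ℕ}
    (hi : i < G.length) (j : ℕ) : clauseAt (G ++ [ψ]) i j = clauseAt G i j := by
  rw [clauseAt_append_singleton, if_pos hi]

/-- **Step (a) of the build: a new, empty formula.** Appending the empty formula clears the guard
coordinate of its rows on side `A` and changes nothing else. [folklore] -/
theorem uCoord_append_nil (F : List (CNF ℕ)) (h H D ℓ r j : ℕ) :
    uCoord (F ++ [[]]) h H D ℓ r j =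
      if r / H = F.length ∧ j = D + 2 * ℓ then false else uCoord F h H D ℓ r j := by
  have hcl : clauseAt (F ++ [[]]) (r / H) j = clauseAt F (r / H) j := by
    rw [clauseAt_append_singleton]
    split_ifs with h1 h2
    · rfl
    · rw [clauseAt_eq_none_of_length_le (le_of_eq h2.symm)]; simp
    · rw [clauseAt_eq_none_of_length_le (by omega)]
  unfold uCoord
  rw [hcl, List.length_append, List.length_singleton]
  split_ifs <;> first | rfl | omega | (simp_all <;> omega)

/-- Step (a) on side `B`: nothing changes. [folklore] -/
theorem vCoord_append_nil (F : List (CNF ℕ)) (h H D ℓ r j : ℕ) :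
    vCoord (F ++ [[]]) h H D ℓ r j = vCoord F h H D ℓ r j := by
  have hcl : clauseAt (F ++ [[]]) (r / H) j = clauseAt F (r / H) j := by
    rw [clauseAt_append_singleton]
    split_ifs with h1 h2
    · rfl
    · rw [clauseAt_eq_none_of_length_le (le_of_eq h2.symm)]; simp
    · rw [clauseAt_eq_none_of_length_le (by omega)]
  unfold vCoord
  rw [hcl]

/-- `clauseAt` when the last formula gets a new last clause. [folklore] -/
theorem clauseAt_snoc_snoc (G : List (CNF ℕ)) (ψ : CNF ℕ) (C : Clause ℕ) (i j : ℕ) :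
    clauseAt (G ++ [ψ ++ [C]]) i j =
      if i = G.length ∧ j = ψ.length then some C else clauseAt (G ++ [ψ]) i j := by
  rw [clauseAt_append_singleton, clauseAt_append_singleton]
  by_cases h1 : i < G.length
  · rw [if_pos h1, if_neg (fun h' => by omega), if_pos h1]
  rw [if_neg h1, if_neg h1]
  by_cases h2 : i = G.length
  · rw [if_pos h2, if_pos h2]
    by_cases hj : j = ψ.length
    · subst hj
      rw [if_pos ⟨h2, rfl⟩, List.getElem?_append_right le_rfl, Nat.sub_self]; rfl
    · rw [if_neg (fun h' => hj h'.2)]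
      rcases Nat.lt_or_gt_of_ne hj with hlt | hgt
      · rw [List.getElem?_append_left hlt]
      · rw [List.getElem?_eq_none_iff.2 (by simp; omega), List.getElem?_eq_none_iff.2 (by omega)]
  · rw [if_neg h2, if_neg h2, if_neg (fun h' => h2 h'.1)]

/-- **Step (b) of the build: a new, empty clause** of the last formula sets its coordinate on
side `A` (the empty clause is satisfied through no literal). [folklore] -/
theorem uCoord_snoc_nilClause (G : List (CNF ℕ)) (ψ : CNF ℕ) (h H D ℓ r j : ℕ)
    (hψ : ψ.length < D) :
    uCoord (G ++ [ψ ++ [[]]]) h H D ℓ r j =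
      if r / H = G.length ∧ j = ψ.length then true else uCoord (G ++ [ψ]) h H D ℓ r j := by
  unfold uCoord
  rw [clauseAt_snoc_snoc, List.length_append, List.length_append, List.length_singleton,
    List.length_singleton]
  split_ifs <;> first | rfl | omega

/-- Step (b) on side `B`. [folklore] -/
theorem vCoord_snoc_nilClause (G : List (CNF ℕ)) (ψ : CNF ℕ) (h H D ℓ r j : ℕ)
    (hψ : ψ.length < D) :
    vCoord (G ++ [ψ ++ [[]]]) h H D ℓ r j =
      if r / H = G.length ∧ j = ψ.length then true else vCoord (G ++ [ψ]) h H D ℓ r j := by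
  unfold vCoord
  rw [clauseAt_snoc_snoc]
  split_ifs <;> first | rfl | omega

/-- `satFirst` of a clause with one more literal. [folklore] -/
theorem satFirst_snoc (h : ℕ) (C : Clause ℕ) (l : Literal ℕ) (p : ℕ) :
    satFirst h (C ++ [l]) p = (satFirst h C p || (decide (l.1 < h) && (p.testBit l.1 == l.2))) := by
  simp [satFirst, List.any_append]

/-- `satSecond` of a clause with one more literal. [folklore] -/
theorem satSecond_snoc (h : ℕ) (C : Clause ℕ) (l : Literal ℕ) (q : ℕ) :
    satSecond h (C ++ [l]) q =
      (satSecond h C q || (decide (h ≤ l.1) && (q.testBit (l.1 - h) == l.2))) := by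
  simp [satSecond, List.any_append]

/-- **Step (c) of the build: a new literal** of the last clause of the last formula clears the
clause's coordinate on side `A` in the rows whose first-half assignment satisfies it. [folklore] -/
theorem uCoord_snoc_snocLit (G : List (CNF ℕ)) (ψ : CNF ℕ) (C : Clause ℕ) (l : Literal ℕ)
    (h H D ℓ r j : ℕ) (hψ : ψ.length < D) :
    uCoord (G ++ [ψ ++ [C ++ [l]]]) h H D ℓ r j =
      if r / H = G.length ∧ j = ψ.length then
        (uCoord (G ++ [ψ ++ [C]]) h H D ℓ r j && !(decide (l.1 < h) && ((r % H).testBit l.1 == l.2)))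
      else uCoord (G ++ [ψ ++ [C]]) h H D ℓ r j := by
  unfold uCoord
  rw [clauseAt_snoc_snoc, clauseAt_snoc_snoc, List.length_append, List.length_append,
    List.length_singleton, List.length_singleton]
  split_ifs <;> first | rfl | omega | simp only [satFirst_snoc, Bool.not_or]

/-- Step (c) on side `B`: the rows whose second-half assignment satisfies the literal. [folklore] -/
theorem vCoord_snoc_snocLit (G : List (CNF ℕ)) (ψ : CNF ℕ) (C : Clause ℕ) (l : Literal ℕ)
    (h H D ℓ r j : ℕ) (hψ : ψ.length < D) :
    vCoord (G ++ [ψ ++ [C ++ [l]]]) h H D ℓ r j =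
      if r / H = G.length ∧ j = ψ.length then
        (vCoord (G ++ [ψ ++ [C]]) h H D ℓ r j &&
          !(decide (h ≤ l.1) && ((r % H).testBit (l.1 - h) == l.2)))
      else vCoord (G ++ [ψ ++ [C]]) h H D ℓ r j := by
  unfold vCoord
  rw [clauseAt_snoc_snoc, clauseAt_snoc_snoc]
  split_ifs <;> first | rfl | omega | simp only [satSecond_snoc, Bool.not_or]

/-- **The empty disjunction: the gadget alone** (the memory after the global initialisation),
side `A`. [folklore] -/
theorem uCoord_nil (h H D ℓ r j : ℕ) :
    uCoord [] h H D ℓ r j =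
      if j < D then false
      else if j < D + ℓ then (r / H).testBit (j - D)
      else if j < D + 2 * ℓ then !(r / H).testBit (j - D - ℓ)
      else if j = D + 2 * ℓ then true else false := by
  unfold uCoord
  rw [clauseAt_eq_none_of_length_le (by simp)]
  simp

/-- The empty disjunction, side `B`. [folklore] -/
theorem vCoord_nil (h H D ℓ r j : ℕ) :
    vCoord [] h H D ℓ r j =
      if j < D then false
      else if j < D + ℓ then !(r / H).testBit (j - D)
      else if j < D + 2 * ℓ then (r / H).testBit (j - D - ℓ)
      else if j = D + 2 * ℓ then true else false := by
  unfold vCoord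
  rw [clauseAt_eq_none_of_length_le (by simp)]

/-- The bit `x` of `p` as computed by the word RAM: `(p >>> x) &&& 1`. [folklore] -/
theorem shiftRight_and_one_eq_toNat_testBit (p x : ℕ) : (p >>> x) &&& 1 = (p.testBit x).toNat := by
  rw [Nat.and_one_is_mod, Nat.shiftRight_eq_div_pow, Nat.testBit_eq_decide_div_mod_eq]
  rcases Nat.mod_two_eq_zero_or_one (p / 2 ^ x) with h0 | h1
  · rw [h0]; simp
  · rw [h1]; simp

/-- Boolean `and` on bits is the bitwise `and` of the words `0`/`1`. [folklore] -/
theorem toNat_and (a b : Bool) : (a && b).toNat = a.toNat &&& b.toNat := by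
  cases a <;> cases b <;> rfl

/-- Boolean `xor` on bits is the bitwise `xor` of the words `0`/`1`. [folklore] -/
theorem toNat_xor (a b : Bool) : (a ^^ b).toNat = a.toNat ^^^ b.toNat := by
  cases a <;> cases b <;> rfl

/-- The scatter step of the program: `!(bit == b) = bit ^^ b`. [folklore] -/
theorem not_beq_eq_xor (a b : Bool) : (!(a == b)) = (a ^^ b) := by
  cases a <;> cases b <;> rfl

/-- Two numbers below `2 ^ ℓ` with the same digits below `ℓ` are equal. [folklore] -/
theorem eq_of_testBit_eq_below {ℓ i i' : ℕ} (hi : i < 2 ^ ℓ) (hi' : i' < 2 ^ ℓ)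
    (h : ∀ t < ℓ, i.testBit t = i'.testBit t) : i = i' := by
  refine Nat.eq_of_testBit_eq fun t => ?_
  rcases Nat.lt_or_ge t ℓ with ht | ht
  · exact h t ht
  · rw [Nat.testBit_lt_two_pow (lt_of_lt_of_le hi (Nat.pow_le_pow_right Nat.two_pos ht)),
      Nat.testBit_lt_two_pow (lt_of_lt_of_le hi' (Nat.pow_le_pow_right Nat.two_pos ht))]

/-- **Orthogonality, row by row.** For rows `r = i H + p`, `r' = i' H + q` with `i, i' < 2 ^ ℓ`
(and `D + 2ℓ + 1 ≤ d`, every formula with at most `D` clauses), the vectors `u_r`, `v_{r'}` are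
orthogonal iff `i = i'`, formula `i` exists, and the glued assignment of `(p, q)` satisfies it.
[folklore] -/
theorem areOrthogonal_iff {N d : ℕ} (hd : D + 2 * ℓ + 1 ≤ d)
    (hD : ∀ ψ ∈ F, ψ.length ≤ D) (r r' : Fin N) (hr : r.1 / H < 2 ^ ℓ) (hr' : r'.1 / H < 2 ^ ℓ) :
    AreOrthogonal ((ovInst F h H D ℓ N d).A r) ((ovInst F h H D ℓ N d).B r') ↔
      r.1 / H = r'.1 / H ∧ ∃ hi : r.1 / H < F.length,
        (F[r.1 / H]).eval (glue h (r.1 % H) (r'.1 % H)) = true := by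
  set i := r.1 / H with hidef
  set i' := r'.1 / H with hi'def
  set p := r.1 % H
  set q := r'.1 % H
  have hA : ∀ j : Fin d, (ovInst F h H D ℓ N d).A r j = uCoord F h H D ℓ r.1 j.1 := fun _ => rfl
  have hB : ∀ j : Fin d, (ovInst F h H D ℓ N d).B r' j = vCoord F h H D ℓ r'.1 j.1 := fun _ => rfl
  show (∀ j : Fin d, ¬ ((ovInst F h H D ℓ N d).A r j = true ∧ (ovInst F h H D ℓ N d).B r' j = true)) ↔ _
  simp only [hA, hB]
  constructor
  · intro horth
    -- the gadget: `i = i'`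
    have hii' : i = i' := by
      refine eq_of_testBit_eq_below hr hr' fun t ht => ?_
      by_contra hne
      cases hti : i.testBit t
      · have hti' : i'.testBit t = true := by
          cases h' : i'.testBit t
          · exact absurd (hti.trans h'.symm) hne
          · rfl
        refine horth ⟨D + ℓ + t, by omega⟩ ⟨?_, ?_⟩
        · show uCoord F h H D ℓ r.1 (D + ℓ + t) = true
          unfold uCoord
          rw [if_neg (by omega), if_neg (by omega), if_pos (by omega)]
          rw [show D + ℓ + t - D - ℓ = t by omega, ← hidef, hti]; rfl
        · show vCoord F h H D ℓ r'.1 (D + ℓ + t) = true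
          unfold vCoord
          rw [if_neg (by omega), if_neg (by omega), if_pos (by omega)]
          rw [show D + ℓ + t - D - ℓ = t by omega, ← hi'def, hti']
      · have hti' : i'.testBit t = false := by
          cases h' : i'.testBit t
          · rfl
          · exact absurd (hti.trans h'.symm) hne
        refine horth ⟨D + t, by omega⟩ ⟨?_, ?_⟩
        · show uCoord F h H D ℓ r.1 (D + t) = true
          unfold uCoord
          rw [if_neg (by omega), if_pos (by omega), Nat.add_sub_cancel_left, ← hidef, hti]
        · show vCoord F h H D ℓ r'.1 (D + t) = true
          unfold vCoord
          rw [if_neg (by omega), if_pos (by omega), Nat.add_sub_cancel_left, ← hi'def, hti']; rfl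
    -- the guard: formula `i` exists
    have hiF : i < F.length := by
      by_contra hle
      refine horth ⟨D + 2 * ℓ, by omega⟩ ⟨?_, ?_⟩
      · show uCoord F h H D ℓ r.1 (D + 2 * ℓ) = true
        unfold uCoord
        rw [if_neg (by omega), if_neg (by omega), if_neg (by omega), if_pos rfl, ← hidef]
        simpa using Nat.not_lt.1 hle
      · show vCoord F h H D ℓ r'.1 (D + 2 * ℓ) = true
        unfold vCoord
        rw [if_neg (by omega), if_neg (by omega), if_neg (by omega), if_pos rfl]
    refine ⟨hii', hiF, ?_⟩
    -- the clauses
    have hlen : (F[i]).length ≤ D := hD _ (List.getElem_mem hiF)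
    rw [cnfEval_glue]
    simp only [List.all_eq_true]
    intro C hC
    obtain ⟨j, hj, rfl⟩ := List.getElem_of_mem hC
    by_contra hfalse
    have hsf : satFirst h (F[i][j]) p = false := by
      cases h1 : satFirst h (F[i][j]) p
      · rfl
      · simp [h1] at hfalse
    have hss : satSecond h (F[i][j]) q = false := by
      cases h1 : satSecond h (F[i][j]) q
      · rfl
      · simp [h1] at hfalse
    refine horth ⟨j, by omega⟩ ⟨?_, ?_⟩
    · show uCoord F h H D ℓ r.1 j = true
      unfold uCoord
      rw [if_pos (by omega), ← hidef, clauseAt_eq_some hiF hj]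
      simpa using hsf
    · show vCoord F h H D ℓ r'.1 j = true
      unfold vCoord
      rw [if_pos (by omega), ← hi'def, ← hii', clauseAt_eq_some hiF hj]
      simpa using hss
  · rintro ⟨hii', hiF, heval⟩ ⟨j, hjd⟩ ⟨hu, hv⟩
    change uCoord F h H D ℓ r.1 j = true at hu
    change vCoord F h H D ℓ r'.1 j = true at hv
    unfold uCoord at hu
    unfold vCoord at hv
    rw [← hi'def, ← hii'] at hv
    rw [← hidef] at hu
    by_cases h1 : j < D
    · rw [if_pos h1] at hu hv
      by_cases hj : j < (F[i]).length
      · rw [clauseAt_eq_some hiF hj] at hu hv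
        simp only [Bool.not_eq_true'] at hu hv
        rw [cnfEval_glue] at heval
        simp only [List.all_eq_true] at heval
        have := heval _ (List.getElem_mem hj)
        rw [hu, hv] at this
        simp at this
      · rw [clauseAt_eq_none_of_le hiF (Nat.not_lt.1 hj)] at hu
        simp at hu
    rw [if_neg h1] at hu hv
    by_cases h2 : j < D + ℓ
    · rw [if_pos h2] at hu hv
      rw [hu] at hv; simp at hv
    rw [if_neg h2] at hu hv
    by_cases h3 : j < D + 2 * ℓ
    · rw [if_pos h3] at hu hv
      rw [hv] at hu; simp at hu
    rw [if_neg h3] at hu hv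
    by_cases h4 : j = D + 2 * ℓ
    · rw [if_pos h4] at hu
      simp only [decide_eq_true_eq] at hu
      omega
    · rw [if_neg h4] at hu
      simp at hu

/-- **The instance has an orthogonal pair iff some formula of the disjunction is satisfiable**
(Williams, TCS 2005, §5.1, proof of Thm. 5.1, applied to `ψ₀ ∨ … ∨ ψ_{s-1}` with the index gadget):
hypotheses — `H = 2^h`, at most `2^ℓ` formulas, `N = 2^ℓ · H` rows, at most `D` clauses per
formula, variables `< n ≤ 2 h`, and `D + 2ℓ + 1 ≤ d` coordinates.
[cite: WilliamsTCS2005, §5.1 (Thm. 5.1, proof)] -/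
theorem hasOrthogonalPair_ovInst_iff {n N d : ℕ} (hHh : H = 2 ^ h) (hF : F.length ≤ 2 ^ ℓ)
    (hN : N = 2 ^ ℓ * H) (hD : ∀ ψ ∈ F, ψ.length ≤ D)
    (hvars : ∀ ψ ∈ F, ∀ C ∈ ψ, ∀ l ∈ C, l.1 < n) (hn : n ≤ 2 * h) (hd : D + 2 * ℓ + 1 ≤ d) :
    (ovInst F h H D ℓ N d).HasOrthogonalPair ↔ ∃ ψ ∈ F, ψ.Satisfiable := by
  have hH : 0 < H := by rw [hHh]; exact Nat.two_pow_pos h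
  have hrow : ∀ r : Fin N, r.1 / H < 2 ^ ℓ := fun r =>
    Nat.div_lt_of_lt_mul (by rw [Nat.mul_comm, ← hN]; exact r.2)
  constructor
  · rintro ⟨r, r', horth⟩
    obtain ⟨-, hiF, heval⟩ := (areOrthogonal_iff hd hD r r' (hrow r) (hrow r')).1 horth
    exact ⟨_, List.getElem_mem hiF, _, heval⟩
  · rintro ⟨ψ, hψ, v, hv⟩
    obtain ⟨i, hiF, rfl⟩ := List.getElem_of_mem hψ
    -- the two half-assignments read off `v`
    set p := Nat.ofBits (fun x : Fin h => v x.1) with hp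
    set q := Nat.ofBits (fun x : Fin h => v (h + x.1)) with hq
    have hpH : p < H := by rw [hHh]; exact Nat.ofBits_lt_two_pow _
    have hqH : q < H := by rw [hHh]; exact Nat.ofBits_lt_two_pow _
    have hi2 : i < 2 ^ ℓ := lt_of_lt_of_le hiF hF
    have hrN : i * H + p < N := by
      calc i * H + p < i * H + H := by omega
        _ = (i + 1) * H := by ring
        _ ≤ 2 ^ ℓ * H := Nat.mul_le_mul_right _ hi2
        _ = N := hN.symm
    have hr'N : i * H + q < N := by
      calc i * H + q < i * H + H := by omega
        _ = (i + 1) * H := by ring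
        _ ≤ 2 ^ ℓ * H := Nat.mul_le_mul_right _ hi2
        _ = N := hN.symm
    have hdiv : (i * H + p) / H = i := by
      rw [Nat.mul_comm, Nat.mul_add_div hH, Nat.div_eq_of_lt hpH, Nat.add_zero]
    have hdiv' : (i * H + q) / H = i := by
      rw [Nat.mul_comm, Nat.mul_add_div hH, Nat.div_eq_of_lt hqH, Nat.add_zero]
    have hmod : (i * H + p) % H = p := by
      rw [Nat.mul_comm, Nat.mul_add_mod, Nat.mod_eq_of_lt hpH]
    have hmod' : (i * H + q) % H = q := by
      rw [Nat.mul_comm, Nat.mul_add_mod, Nat.mod_eq_of_lt hqH]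
    refine ⟨⟨i * H + p, hrN⟩, ⟨i * H + q, hr'N⟩, ?_⟩
    rw [areOrthogonal_iff hd hD _ _ (by simp only; rw [hdiv]; exact hi2)
      (by simp only; rw [hdiv']; exact hi2)]
    simp only
    rw [hdiv, hdiv', hmod, hmod']
    refine ⟨rfl, hiF, ?_⟩
    -- the glued assignment agrees with `v` on the variables of `F[i]`
    rw [← hv]
    refine cnfEval_congr fun C hC l hl => ?_
    have hx : l.1 < n := hvars _ (List.getElem_mem hiF) C hC l hl
    unfold glue
    by_cases h1 : l.1 < h
    · rw [if_pos h1, hp, Nat.testBit_ofBits_lt _ _ h1]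
    · rw [if_neg h1, hq, Nat.testBit_ofBits_lt _ _ (by omega)]
      simp only
      congr 1; omega

end inst

/-! ### The word encoding of the instance, cell by cell -/

section encode

variable (F : List (CNF ℕ)) (h H D ℓ N d : ℕ)

/-- The word at position `t` of the encoding of the instance: `N`, `d`, the `N · d` bits of side
`A` row-major, the `N · d` bits of side `B` row-major. [folklore] -/
def ycell (t : ℕ) : ℕ :=
  if t = 0 then N
  else if t = 1 then d
  else if t < 2 + N * d then (uCoord F h H D ℓ ((t - 2) / d) ((t - 2) % d)).toNat
  else (vCoord F h H D ℓ ((t - 2 - N * d) / d) ((t - 2 - N * d) % d)).toNat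

/-- Rows of a table over `ℕ` indices, flattened row-major. [folklore] -/
theorem flatMap_range_rows (V : ℕ → ℕ → Bool) :
    ((List.range N).flatMap fun r => (List.range d).map fun j => (V r j).toNat) =
      (List.range (N * d)).map fun t => (V (t / d) (t % d)).toNat := by
  induction N with
  | zero => simp
  | succ N ih =>
    rw [List.range_succ, List.flatMap_append, ih, Nat.succ_mul, List.range_add, List.map_append,
      List.map_map]
    simp only [List.flatMap_cons, List.flatMap_nil, List.append_nil]
    congr 1
    refine List.map_congr_left fun j hj => ?_
    have hjd : j < d := List.mem_range.1 hj
    have hd : 0 < d := by omega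
    simp only [Function.comp_apply]
    rw [Nat.add_comm, Nat.add_mul_div_right _ _ hd, Nat.div_eq_of_lt hjd, Nat.zero_add,
      Nat.add_mul_mod_self_right, Nat.mod_eq_of_lt hjd]

/-- Rows of a table, flattened row-major. [folklore] -/
theorem flatMap_finRange_encodeBoolVec (V : ℕ → ℕ → Bool) :
    ((List.finRange N).flatMap fun r : Fin N => encodeBoolVec fun j : Fin d => V r.1 j.1) =
      (List.range (N * d)).map fun t => (V (t / d) (t % d)).toNat := by
  rw [← flatMap_range_rows, ← List.map_coe_finRange_eq_range (n := N), List.flatMap_map]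
  refine List.flatMap_congr fun r _ => ?_
  simp only [encodeBoolVec]
  rw [← List.map_coe_finRange_eq_range (n := d), List.map_map]
  rfl

/-- The length of the encoding of the instance. [folklore] -/
theorem length_encode_ovInst :
    (OVInstance.encode (ovInst F h H D ℓ N d)).length = 2 + 2 * (N * d) := by
  simp only [OVInstance.encode, ovInst, List.length_cons, List.length_append]
  rw [flatMap_finRange_encodeBoolVec N d (uCoord F h H D ℓ),
    flatMap_finRange_encodeBoolVec N d (vCoord F h H D ℓ)]
  simp; ring

/-- **The encoding of the instance, cell by cell.** [folklore] -/
theorem getElem_encode_ovInst {t : ℕ} (ht : t < (OVInstance.encode (ovInst F h H D ℓ N d)).length) :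
    (OVInstance.encode (ovInst F h H D ℓ N d))[t] = ycell F h H D ℓ N d t := by
  have hlen := length_encode_ovInst F h H D ℓ N d
  have hA := flatMap_finRange_encodeBoolVec N d (uCoord F h H D ℓ)
  have hB := flatMap_finRange_encodeBoolVec N d (vCoord F h H D ℓ)
  have henc : OVInstance.encode (ovInst F h H D ℓ N d) =
      N :: d :: (((List.range (N * d)).map fun t => (uCoord F h H D ℓ (t / d) (t % d)).toNat) ++
        ((List.range (N * d)).map fun t => (vCoord F h H D ℓ (t / d) (t % d)).toNat)) := by
    simp only [OVInstance.encode, ovInst] at hA hB ⊢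
    rw [hA, hB]
  rw [hlen] at ht
  rw [List.getElem_of_eq henc]
  unfold ycell
  rcases t with _ | _ | t
  · simp
  · simp
  · rw [if_neg (by omega), if_neg (by omega)]
    simp only [List.getElem_cons_succ]
    by_cases h1 : t < N * d
    · rw [if_pos (by omega), List.getElem_append_left (by simpa using h1)]
      simp
    · rw [if_neg (by omega), List.getElem_append_right (by simpa using h1)]
      simp only [List.length_map, List.length_range, List.getElem_map, List.getElem_range]
      congr 2

/-- All words of the encoding are at most `max N d` (and the bits at most `1`). [folklore] -/
theorem ycell_le (t : ℕ) : ycell F h H D ℓ N d t ≤ max (max N d) 1 := by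
  unfold ycell
  split_ifs
  · exact le_trans (le_max_left _ _) (le_max_left _ _)
  · exact le_trans (le_max_right _ _) (le_max_left _ _)
  · exact le_trans (Bool.toNat_le _) (le_max_right _ _)
  · exact le_trans (Bool.toNat_le _) (le_max_right _ _)

end encode

end Literature.Computability.FineGrained.OVRed
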